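import Summits.AnomalousDissipation.AnomalousDissipation.Theorems.MarginalStabilityChainStrainedLayerLawSumRuleLine
import Summits.AnomalousDissipation.AnomalousDissipation.Theorems.MarginalStabilityChainStrainedLayerLawStubCoreFloor
import Summits.AnomalousDissipation.AnomalousDissipation.Theorems.MarginalStabilityChainStrainedLayerLawSumRuleShearTails
import HarnessLib.Audit

/-!
# Line `index-gap-quantised-dissipation` — checked skeleton for crux `MarginalStabilityChain.StrainedLayerLaw`
(item stmt-AnomalousDissipation-3007, route route-AnomalousDissipation-MarginalStabilityChain; planner crux-plan,
idea card `Cruxes/StrainedLayerLaw/Ideas/index-gap-quantised-dissipation.md`, triage r2-1/r2-2/r2-3 PASS)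

Crux (FIXED; `Theses/MarginalStabilityChain.lean`): `∃ c > 0 ∀ L > 0 ∃ ν₀ > 0 ∃ θ` admissible `∀ ν ∈ (0,ν₀] ∀ (u,v,p)`
global classical solutions of the stretched 2-D Navier–Stokes class (γ = ΔU = 1, period `L`) from `U_B^ν + θ`:
`ofReal (c·min L 1) ≤ liminf_T ofReal T⁻¹ ∫⁻_{(0,T]} D`.

## The line (one paragraph) — ν-UNIFORMITY RIDES ON EQUILIBRIUM VALUES, NOT ON DYNAMICS
Every one of the seven dead lines on this crux typed its load-bearing stub as a ν-UNIFORM ETERNAL floor on the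
dynamics (capture / concentration / roundness / strain-work floors) and was kernel-checked equivalent to the crux modulo
hygiene. This line changes the TYPE: (G) at FIXED ν every tailed finite-dissipation member converges, modulo
`x`-translation, to a RELATIVE EQUILIBRIUM `e` (travelling wave of the cell) and its dissipation converges to `D(e)`
(qualitative, fixed-ν, no rate, no uniformity); (NP)+(LM) the INDEX GAP, a STATIC statement about the equilibrium zoo:
for `ν ≤ ν₂(L)` every tailed relative equilibrium with `D(e) < c₀·min(L,1)` carries TWO unstable directions (the laminar
layer by long-wave Kelvin–Helmholtz at a cell harmonic — `αRe = √(2π)k/L` is ν-FREE —; thin sheets by KH; `N ≥ 3`-rows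
by the `N − 1` pairing modes; `D` is QUANTISED on rows, `D(N-row) = L/(8πN)`, Disproof §3); (A) GENERIC AVOIDANCE: for
one admissible `θ` (generic: the bad set is a countable union over dyadic ν-shells of projections of codimension-2
centre-stable manifolds, hence meagre) no tailed member from `U_B^ν + θ`, `ν ≤ ν₃`, converges to a doubly-unstable
relative equilibrium. Then `liminf` of the Cesàro means `= lim D(t) = D(e) ≥ c₀ min(L,1)` by the landed Cesàro floor
lemma (`le_liminf_cesaro_of_floor`, p125290's file) — the terminal-value transfer is PROVED below, not a stub; the
`⊤`-dichotomy ("some `∫⁻₀^{T₀} D = ⊤` ⇒ the means are eventually `⊤`") is proved below too. Hygiene (H) is the sum-rule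
line's registered `stub_bareClassTails` VERBATIM (repair-only in the bare class; conditional closure
`bareClassTails_of_hasShearLayerTails`, p120875, imported for the record).

## Stubs (7 registered after the lead's reshape, a3 2026-08-17; sorries ONLY inside `stub_*`; `StrainedLayerLaw_of`
## concludes the route decl BY NAME)
* H  `stub_bareClassTails`            — hygiene, shared registered signature (sum-rule / clock lines), blocked on the class repair.
* LW `stub_longWaveKH`                — `∃ α₁ h₀ c₁ > 0, BurgersLayerKHLongWave α₁ h₀ c₁`: 3008's `StrainedPackage` made uniform
                                        in `α ∈ (0, α₁]` via the α-free sheet-coefficient identity (L; the lead's stub).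
* LM1 `stub_laminarProfile`           — a PARALLEL relative equilibrium of the `L`-cell is the Burgers layer `U_B^ν`, `ve = 0`
                                        (ODE uniqueness; M).
* LM2 `stub_laminarUnstable`          — LW ⇒ the Burgers layer has two unstable directions for `ν ≤ ν₁(L)`, any drift `c`
                                        (explicit cell-harmonic KH mode in vorticity–stream-function form; L).
  (LM = LM1 + LM2, combined by the proved `laminarModes_of`; `TwoUnstableDirections` is now in vorticity–stream-function
  form — one stream function per direction, `linVort`, no pressure.)
* NP `stub_indexGapNonparallel`       — HARDEST STATIC stub: `∃ c₀ ∀ L ∃ ν₂ ∀ ν ≤ ν₂`, every NON-parallel tailed relative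
                                        equilibrium with `D(e) < c₀ min(L,1)` has two unstable directions (XL, conjectural).
* G  `stub_convergenceToEquilibrium`  — the ONE dynamical bet, fixed ν: tailed finite-dissipation members converge mod
                                        translation to a tailed relative equilibrium, with `D(t) → D(e)` (XL, conjectural).
* A  `stub_genericAvoidance`          — `∀ L ∃ θ` admissible `∃ ν₃ ∀ ν ≤ ν₃`: tailed members from `U_B^ν + θ` never converge to a
                                        doubly-unstable relative equilibrium (Henry/Brunovský–Raugel genericity + Baire; L–XL).
The vocabulary (`IsRelEquilibrium`, `IsPerturbation`, `pertVort`, `linVort`, `TwoUnstableDirections`,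
`ConvergesModTranslation`, `BurgersLayerKHLongWave`), the proved transfer lemmas, `laminarModes_of` and the sorry-free
CONDITIONAL composition
`StrainedLayerLaw_of_indexGapStubs` are meant to be landed first by the lead as
`Theorems/MarginalStabilityChainStrainedLayerLawIndexGapLine.lean` (exactly as the sum-rule line landed `…SumRuleLine.lean`,
p97772), so that stubs landed one by one `--supports stmt-AnomalousDissipation-3007` speak about the SAME declarations.

## Disproof / negatives honoured (`Cruxes/StrainedLayerLaw/Disproof.lean`, read in full)
* §2 `lawAt_zero_false` / `not_strainedLayerLaw_theta_zero` / `not_strainedLayerLaw_forall_theta` (`∃θ` is load-bearing):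
  θ enters at stub A ONLY and is existential (generic) there; θ = 0 relaminarises and the laminar state IS doubly unstable
  for `ν ≤ ν₁` (LM), so A's θ is automatically ≠ 0 — consistent, not contradicted.
* §4/§4b `lawAt_parallel_false_of_relaxation`, `lawAt_thickLayer_false` (x-independent data relaminarise): the same
  mechanism — A's θ must be `x`-dependent; no stub quantifies over all θ.
* §3 `strainedRow_pairing_unstable` (pairing IS unstable under the strain) is the index count behind NP for rows;
  `row_dissipation_per_area` (`D = L/(8πN)`) is the quantisation that puts `N = 1, 2` (index 0, 1) above and `N ≥ 3`
  (index `N − 1 ≥ 2`) below any `c₀ ∈ (1/24π, 1/16π)`; `liminf_timeMean_const`: our transfer lemmas agree on constants.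
* §7 `UniqueInClass` "doubtful as stated": carried by H (inherited, flagged), and A/G are stated for TAILED
  finite-dissipation members only.
* Triage r2-1/r2-2: the `S`-symmetric class of the card is DROPPED (there `index_S(N-row) = ⌊(N−1)/2⌋` breaks the gap);
  relative equilibria (drift `c`) replace steady states; `c₀` is existential (typing checklist (iv)).
* No `-- Targets` stub kill names any statement of this shape; no `Theorems/StrainedLayerLaw*/Negative` module exists;
  `ledger negatives --problem AnomalousDissipation`: no stub is an instance (none is a ν-uniform dynamical floor, none
  quantifies the law over all θ, none is 3010/3011-shaped).
-/

set_option linter.dupNamespace false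

noncomputable section

open scoped Topology ENNReal
open Filter Set Function MeasureTheory

namespace Summit.AnomalousDissipation.AnomalousDissipation.Cruxes.StrainedLayerLaw.IndexGapQuantisedDissipation

open Literature.Analysis.FluidPDE Literature.Analysis.FluidPDE.StretchedLayer
open Summit.AnomalousDissipation.AnomalousDissipation.Theses.MarginalStabilityChain
open Summit.AnomalousDissipation.AnomalousDissipation.Theorems.StrainedLayerLaw.StrainWorkSumRule
open Summit.AnomalousDissipation.AnomalousDissipation.Theorems.StrainedLayerLaw.ContractionCapture

/-! ## §0 Vocabulary of the line (definitions; no content is asserted) -/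

/-- **Relative equilibrium of the cell with drift `c`**: a travelling wave `u(t,x,y) = ue(x − ct, y)`, `v = ve(x − ct, y)`,
`p = pe(x − ct, y)` of the crux's stretched 2-D Navier–Stokes system (γ = ΔU = 1, viscosity `ν`, period `L`), written as
the steady system in the co-moving frame: `ue, ve ∈ C²`, `pe ∈ C¹`,
`(ue − c)∂ₓue + (ve − y)∂_y ue = −∂ₓpe + νΔue`, `(ue − c)∂ₓve + (ve − y)∂_y ve − ve = −∂_y pe + νΔve`, `∂ₓue + ∂_y ve = 0`,
`L`-periodic in `x`, far field `ue → ±½`, `ve → 0`. The parallel members are exactly the Burgers layers `U_B^ν` (any `c`).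
[folklore] -/
def IsRelEquilibrium (ν L c : ℝ) (ue ve pe : ℝ → ℝ → ℝ) : Prop :=
  ContDiff ℝ 2 (fun q : ℝ × ℝ => ue q.1 q.2) ∧ ContDiff ℝ 2 (fun q : ℝ × ℝ => ve q.1 q.2) ∧
  ContDiff ℝ 1 (fun q : ℝ × ℝ => pe q.1 q.2) ∧
  (∀ x y, (ue x y - c) * dX ue x y + (ve x y - y) * dY ue x y = -dX pe x y + ν * lap ue x y) ∧
  (∀ x y, (ue x y - c) * dX ve x y + (ve x y - y) * dY ve x y - ve x y = -dY pe x y + ν * lap ve x y) ∧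
  (∀ x y, dX ue x y + dY ve x y = 0) ∧
  (∀ x y, ue (x + L) y = ue x y ∧ ve (x + L) y = ve x y ∧ pe (x + L) y = pe x y) ∧
  (∀ x, Tendsto (fun y => ue x y) atTop (𝓝 (1 / 2)) ∧ Tendsto (fun y => ue x y) atBot (𝓝 (-(1 / 2))) ∧
    Tendsto (fun y => ve x y) atTop (𝓝 0) ∧ Tendsto (fun y => ve x y) atBot (𝓝 0))

/-- **Admissible linear perturbation of the cell, as a STREAM FUNCTION `φ`** (velocity `u' = ∂_yφ`, `v' = −∂ₓφ`,
vorticity `ω' = −Δφ`; divergence-freeness is automatic): `φ ∈ C⁴(ℝ²)` (so that the linearised vorticity equation is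
classical), `L`-periodic in `x`, and `φ` together with its first and second slice derivatives decays like `C e^{−κ|y|}`
uniformly in `x` (finite energy and enstrophy; excludes the spurious algebraically-behaved branch of the mode equation at
`|y| = ∞`). Lead's reshape (a3, 2026-08-17) of the planner's primitive-variable triple `(f, g, q)`: same content, no
pressure reconstruction. [folklore] -/
def IsPerturbation (L : ℝ) (φ : ℝ → ℝ → ℝ) : Prop :=
  ContDiff ℝ 4 (fun z : ℝ × ℝ => φ z.1 z.2) ∧ (∀ x y, φ (x + L) y = φ x y) ∧
  ∃ C κ : ℝ, 0 < κ ∧ ∀ x y,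
    |φ x y| + |dX φ x y| + |dY φ x y| + |dX (dX φ) x y| + |dX (dY φ) x y| + |dY (dY φ) x y| ≤
      C * Real.exp (-κ * |y|)

/-- Perturbation vorticity of a stream function: `ω' = ∂ₓv' − ∂_yu' = −Δφ` for `(u', v') = (∂_yφ, −∂ₓφ)`. [folklore] -/
def pertVort (φ : ℝ → ℝ → ℝ) (x y : ℝ) : ℝ := -lap φ x y

/-- The **linearised vorticity operator** of the co-moving stretched system at the relative equilibrium `(c, ue, ve)`
(base vorticity `Ω = ∂ₓve − ∂_yue = vorticity ue ve`), applied to a stream-function perturbation `φ`: linearising the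
class's vorticity equation `∂ₜω + u∂ₓω + (v − y)∂_yω = ω + νΔω` (curl of the crux's momentum equations) about
`(ue − c, ve)` gives `∂ₜω' = −[(ue − c)∂ₓω' + (ve − y)∂_yω' + u'∂ₓΩ + v'∂_yΩ] + ω' + νΔω'` with `u' = ∂_yφ`,
`v' = −∂ₓφ`, `ω' = pertVort φ`. [folklore] -/
def linVort (ν c : ℝ) (ue ve φ : ℝ → ℝ → ℝ) (x y : ℝ) : ℝ :=
  -((ue x y - c) * dX (pertVort φ) x y + (ve x y - y) * dY (pertVort φ) x y +
      dY φ x y * dX (vorticity ue ve) x y + (-dX φ x y) * dY (vorticity ue ve) x y) +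
    pertVort φ x y + ν * lap (pertVort φ) x y

/-- **Two unstable directions** of the relative equilibrium `(c, ue, ve)`: a real two-plane `span{φ₁, φ₂}` of admissible
stream-function perturbations (linearly independent) that is INVARIANT under the linearised vorticity dynamics
`∂ₜ(pertVort φ) = linVort φ`, with matrix `[[a, b'], [b, d]]` of positive trace and positive determinant — i.e. both
eigenvalues in `re > 0`. This covers two real unstable modes, a complex unstable pair (ONE complex Kelvin–Helmholtz mode
`ψ(y)e^{iαx}` gives `φ₁ = re`, `φ₂ = im`, matrix `[[re σ, im σ], [−im σ, re σ]]`), and an unstable Jordan block; it says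
"real unstable dimension ≥ 2" without any spectral theory. Invariant under `x`-translation of `(ue, ve)`; the drift `c`
only Doppler-shifts `im σ`. [folklore] -/
def TwoUnstableDirections (ν L c : ℝ) (ue ve : ℝ → ℝ → ℝ) : Prop :=
  ∃ (a b b' d : ℝ) (φ₁ φ₂ : ℝ → ℝ → ℝ),
    0 < a + d ∧ 0 < a * d - b * b' ∧ IsPerturbation L φ₁ ∧ IsPerturbation L φ₂ ∧
    (∀ s r : ℝ, (∀ x y, s * φ₁ x y + r * φ₂ x y = 0) → s = 0 ∧ r = 0) ∧
    ∀ x y,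
      linVort ν c ue ve φ₁ x y = a * pertVort φ₁ x y + b * pertVort φ₂ x y ∧
      linVort ν c ue ve φ₂ x y = b' * pertVort φ₁ x y + d * pertVort φ₂ x y

/-- **Convergence modulo translation** of the time-dependent fields `(u, v)` to the plane fields `(ue, ve)`: for some phase
`s : ℝ → ℝ` (free — it absorbs the drift `ct` and any slow wandering along the translation orbit),
`(u, v, ∇u, ∇v)(t, x, y) − (ue, ve, ∇ue, ∇ve)(x − s(t), y) → 0` uniformly in `(x, y)` as `t → ∞`. [folklore] -/
def ConvergesModTranslation (u v : ℝ → ℝ → ℝ → ℝ) (ue ve : ℝ → ℝ → ℝ) : Prop :=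
  ∃ s : ℝ → ℝ, ∀ ε : ℝ, 0 < ε → ∀ᶠ t in atTop, ∀ x y : ℝ,
    |u t x y - ue (x - s t) y| + |v t x y - ve (x - s t) y| +
      |dX (u t) x y - dX ue (x - s t) y| + |dY (u t) x y - dY ue (x - s t) y| +
      |dX (v t) x y - dX ve (x - s t) y| + |dY (v t) x y - dY ve (x - s t) y| ≤ ε

/-- **Long-wave Kelvin–Helmholtz instability of the exact Burgers layer, UNIFORM in the wavenumber** (the card's first
lemma, VERBATIM from `Cruxes/StrainedLayerLaw/FirstLemmasK5.lean`; same operator, class and normalisation as the route's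
PROVED crux `BurgersLayerKH` (3008), whose witness fixes ONE small `α`): there are `α₁, h₀, c₁ > 0` such that for every
`α ∈ (0, α₁]` and every `Re > 0` with `h := 1/(α Re) ≤ h₀` the linearised stretched-vorticity operator about
`U(y) = ∫₀ʸ e^{−s²/2} ds` has a Gaussian-class eigenmode with `re σ ≥ c₁·α·Re`. For the k-th harmonic of a cell of period `L`
at viscosity `ν`: `α = 2πk√ν/L → 0` and `α·Re = √(2π)k/L` is INDEPENDENT of `ν` (`SketchK5.alphaRe_cellHarmonic`, proved), so
the harmonic `k = ⌈L/(√(2π)h₀)⌉` is unstable for ALL small `ν`. What is missing from the landed 3008 stubs: the smallness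
`h ≤ h₀(α, ε)` of `StrainedPackage α ε` must be made uniform in `α ∈ (0, α₁]`. A PREDICATE of its three constants
`(α₁, h₀, c₁)` (the registered stub `stub_longWaveKH` quantifies them: `∃ α₁ h₀ c₁ > 0, BurgersLayerKHLongWave α₁ h₀ c₁`).
[folklore] -/
def BurgersLayerKHLongWave (α₁ h₀ c₁ : ℝ) : Prop :=
  ∀ α Re : ℝ, 0 < α → α ≤ α₁ → 0 < Re →
    1 ≤ α * Re * h₀ →
    ∃ (σ : ℂ) (ψ : ℝ → ℂ), let U : ℝ → ℝ := fun y => ∫ s in (0:ℝ)..y, Real.exp (-(s ^ 2) / 2); let U'' : ℝ → ℝ := fun y => -(y * Real.exp (-(y ^ 2) / 2)); let ω : ℝ → ℂ := fun y => -(iteratedDeriv 2 ψ y - (α : ℂ) ^ 2 * ψ y); c₁ * (α * Re) ≤ σ.re ∧ ContDiff ℝ 4 ψ ∧ (∃ y, ψ y ≠ 0) ∧ Filter.Tendsto ψ Filter.atTop (nhds 0) ∧ Filter.Tendsto ψ Filter.atBot (nhds 0) ∧ (∃ C : ℝ, ∀ y : ℝ, ‖ω y‖ ≤ C * Real.exp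 (-(y ^ 2) / 4)) ∧ ∀ y : ℝ, σ * ω y = -(Complex.I * α * Re) * ((U y : ℂ) * ω y + (U'' y : ℂ) * ψ y) + ω y + (y : ℂ) * deriv ω y + iteratedDeriv 2 ω y - (α : ℂ) ^ 2 * ω y

/-! ## §1 Proved transfer lemmas (the only time-averaging the line needs) -/

/-- **`⊤`-dichotomy.** If some initial dissipation integral `∫⁻_{(0,T₀]} D` is infinite, the Cesàro means are eventually `⊤`
and so is their `liminf` (pattern of the landed `floorTransfer_direct`, first branch). [folklore] -/
theorem liminf_cesaro_eq_top_of_not_locFinite {D : ℝ → ℝ≥0∞}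
    (h : ¬ ∀ T : ℝ, 0 < T → ∫⁻ t in Ioc 0 T, D t ≠ ∞) :
    liminf (fun T : ℝ => ENNReal.ofReal T⁻¹ * ∫⁻ t in Ioc 0 T, D t) atTop = ⊤ := by
  push Not at h
  obtain ⟨T₀, hT₀, htop⟩ := h
  have hev : ∀ᶠ T in atTop, ENNReal.ofReal T⁻¹ * ∫⁻ t in Ioc 0 T, D t = (⊤ : ℝ≥0∞) := by
    filter_upwards [eventually_ge_atTop T₀] with T hT
    have hmono : ∫⁻ t in Ioc 0 T₀, D t ≤ ∫⁻ t in Ioc 0 T, D t :=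
      lintegral_mono_set (Ioc_subset_Ioc_right hT)
    rw [htop, top_le_iff] at hmono
    rw [hmono, ENNReal.mul_top]
    exact (ENNReal.ofReal_pos.mpr (inv_pos.mpr (hT₀.trans_le hT))).ne'
  rw [Filter.liminf_congr hev, Filter.liminf_const]

/-- **Terminal-value transfer** (the card's `TerminalValueTransfer`, lower-bound half, which is all the crux needs): if the
slice dissipation `D(t)` CONVERGES in `[0,∞]` to `d` and `K ≤ d`, then `K ≤ liminf_T ofReal T⁻¹ ∫⁻_{(0,T]} D` — for every
`K' < K` eventually `K' < D(t)`, and the landed Cesàro floor lemma `le_liminf_cesaro_of_floor` applies. ν-uniformity enters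
the line ONLY through the VALUE `d = D(e)` of the limiting equilibrium. [folklore] -/
theorem le_liminf_cesaro_of_tendsto {D : ℝ → ℝ≥0∞} {d K : ℝ≥0∞} (hD : Tendsto D atTop (𝓝 d)) (hK : K ≤ d) :
    K ≤ liminf (fun T : ℝ => ENNReal.ofReal T⁻¹ * ∫⁻ t in Ioc 0 T, D t) atTop := by
  refine le_of_forall_lt_imp_le_of_dense fun K' hK' => ?_
  have hev : ∀ᶠ t in atTop, K' < D t := hD.eventually (lt_mem_nhds (hK'.trans_le hK))
  obtain ⟨T₂, hT₂⟩ := eventually_atTop.1 hev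
  exact le_liminf_cesaro_of_floor (le_max_right T₂ 0) fun t ht => (hT₂ t ((le_max_left T₂ 0).trans ht)).le

/-! ## §2 The registered stubs -/

/-- **Stub H — TAILS IN THE BARE CLASS (hygiene; the sum-rule line's registered signature VERBATIM; CONJECTURAL in the bare
class, repair-only).** Every member of the crux's BARE classical class from the Gaussian-tailed datum `U_B^ν + θ` (θ admissible)
whose dissipation is locally integrable in time has uniform exponential shear tails on every compact `[a,b] ⊂ (0,∞)`. True for
the PHYSICAL solution; in the bare class it is the well-posedness/uniqueness debt (refuter notes M1/M3, Disproof §4/§7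
`UniqueInClass`); conditional closure under the recommended class repair is LANDED (`bareClassTails_of_hasShearLayerTails`,
p120875). This line does not re-attack it. WHY IT MIGHT FAIL: a finite-dissipation classical ghost with algebraic approach to
`±½` from the same datum. SIZE: open in the bare class / zero under the repair. [folklore] -/
theorem stub_bareClassTails : ∀ (ν L : ℝ), 0 < ν → 0 < L → ∀ (θ₁ θ₂ : ℝ → ℝ → ℝ), IsAdmissible L θ₁ θ₂ →
    ∀ (u v p : ℝ → ℝ → ℝ → ℝ), InCruxClass ν L θ₁ θ₂ u v p →
      (∀ T : ℝ, 0 < T → ∫⁻ t in Ioc 0 T, layerDissipation ν L (u t) (v t) ≠ ∞) →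
        ∀ a b : ℝ, 0 < a → a < b → ExpTails (Icc a b) u v := by
  sorry

/-- **Stub LW — LONG-WAVE KELVIN–HELMHOLTZ, UNIFORM IN α** (`BurgersLayerKHLongWave`; the layer case of the index gap).
PLAUSIBLY TRUE: the 3008 line (`Theorems/MarginalStabilityChainBurgersLayerKHLine.lean`, `BurgersLayerKH_of`) proves exactly
this at ONE small `α`; its packages `VolterraPackage`, `RayleighJostPackage`, `SheetLimitPackage` are already uniform in
`α ∈ (0, α₁]`, and only the smallness `h₀(α, ε)` of `StrainedPackage α ε` (Weber exponential dichotomy, `μ = re λ/h + α² − ½`)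
must be tracked uniformly as `α → 0`. WHY IT MIGHT FAIL: only by a hidden `α`-dependence of the strained persistence constant
(none is expected: every constant of the 3008 proof is monotone-harmless as `α ↓ 0`). Lead a3's route: the 3008
closeness estimate `‖a_h − a_0‖ ≤ Lc·h/(2α)` loses `1/α` through `a = 1 − (2α)⁻¹∫e^{αt}ω`; integrating the mode equation
once against `e^{αt}` gives the EXACT α-free identity `a = [λ + iU₊ − i∫U′m + (h/2)∫t e^{αt}ω]/(λ − iU₊)` (`m = e^{αy}ψ`),
whence `‖a_h − a_0‖ ≤ C·h` uniformly in `α` from the landed h-uniform resolvent and Volterra packages. SIZE: L. [folklore] -/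
theorem stub_longWaveKH : ∃ α₁ h₀ c₁ : ℝ, 0 < α₁ ∧ 0 < h₀ ∧ 0 < c₁ ∧ BurgersLayerKHLongWave α₁ h₀ c₁ := by
  sorry

/-- **Stub LM1 — A PARALLEL RELATIVE EQUILIBRIUM IS THE BURGERS LAYER** (lead a3's reshape of LM, part (i)). If `ue`
does not depend on `x` then: `∂ₓue = 0` and `∂ₓue + ∂_y ve = 0` give `∂_y ve = 0`, so `ve(x, ·)` is constant and the far
field `ve → 0` forces `ve = 0`; the `x`-momentum equation reduces to `∂ₓpe = νU″ + yU′` (a function of `y` alone), and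
`L`-periodicity of `pe` forces it to vanish; the ODE `νU″ + yU′ = 0` (`U = ue(x, ·) ∈ C²`) integrates to
`U′ = A e^{−y²/(2ν)}` and the far field `U(±∞) = ±½` fixes `U = U_B^ν = burgersLayerProfile 1 ν 1`
(`burgersLayerProfile_one_eq`: `(2πν)^{-1/2}∫₀ʸ e^{−s²/(2ν)} ds`). The drift `c` drops out (`∂ₓ ≡ 0`). WHY IT MIGHT FAIL: it
should not (explicit ODE uniqueness; the only traps are the slice-derivative bookkeeping `dX/dY/lap = deriv` of `C²` fields
and the Gaussian integral `∫ e^{−s²/(2ν)} = √(2πν)`). SIZE: M. [folklore] -/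
theorem stub_laminarProfile : ∀ (ν L c : ℝ) (ue ve pe : ℝ → ℝ → ℝ), 0 < ν → 0 < L →
    IsRelEquilibrium ν L c ue ve pe → (∀ x x' y : ℝ, ue x y = ue x' y) →
      ∀ x y : ℝ, ue x y = burgersLayerProfile 1 ν 1 y ∧ ve x y = 0 := by
  sorry

/-- **Stub LM2 — THE BURGERS LAYER IS DOUBLY UNSTABLE IN EVERY CELL FOR SMALL ν** (lead a3's reshape of LM, parts
(ii)–(iii)). From LW with constants `(α₁, h₀, c₁)`: given `L`, take the cell harmonic `k = ⌈L/(√(2π)h₀)⌉ ≥ 1` and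
`ν₁ := (α₁L/(2πk))²`; for `ν ≤ ν₁`, `α := 2πk√ν/L ≤ α₁` and with `Re := (2πν)^{-1/2}` one has `α·Re = √(2π)k/L ≥ 1/h₀`
INDEPENDENTLY of ν (`SketchK5.alphaRe_cellHarmonic`), so LW yields `(σ, ψ)` with `re σ ≥ c₁αRe > 0`. In cell variables
(`X = x/√ν`, `Y = y/√ν`; `U_B^ν(y) = U(Y)/√(2π)`, `U(Y) = ∫₀^Y e^{−s²/2}ds`) the complex stream function
`Φ(x, y) := ψ(Y)·e^{iαX}` has `pertVort Φ = ν⁻¹ω(Y)e^{iαX}` (`ω = −(ψ″ − α²ψ)`) and, by the chain rule term by term,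
`linVort ν c U_B^ν 0 Φ = (σ + icα/√ν)·pertVort Φ` — this IS the eigen-equation of LW after multiplying by `ν`. Hence
`φ₁ := re Φ`, `φ₂ := im Φ` satisfy `linVort φ₁ = p·ω₁ − q·ω₂`, `linVort φ₂ = q·ω₁ + p·ω₂` with `p = re σ > 0`,
`q = im σ + cα/√ν`: matrix `a = d = p`, `b = −q`, `b' = q`, trace `2p > 0`, determinant `p² + q² > 0`. `IsPerturbation`:
`Φ ∈ C⁴` from `ψ ∈ C⁴`; `L`-periodicity from `αL/√ν = 2πk`; exponential decay of `ψ, ψ′, ψ″` from `ψ″ = α²ψ − ω`,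
`ψ → 0` at `±∞`, `ω` Gaussian (integrating factor: `g := ψ′ + αψ` has `(e^{−αy}g)′ = −e^{−αy}ω`, and `ψ → 0` kills both
free constants, giving `|ψ| + |ψ′| ≤ C e^{−α|y|}`). Linear independence: `s·re Φ + r·im Φ ≡ 0` with `ψ ≢ 0`, `α ≠ 0` forces
`s = r = 0`. WHY IT MIGHT FAIL: it should not — changes of variables only; the risk is formalisation size (chain rules for
`(x, y) ↦ re/im(ψ(y/√ν)e^{iαx/√ν})` up to fourth slice derivatives, the decay lemma). SIZE: L. [folklore] -/
theorem stub_laminarUnstable : (∃ α₁ h₀ c₁ : ℝ, 0 < α₁ ∧ 0 < h₀ ∧ 0 < c₁ ∧ BurgersLayerKHLongWave α₁ h₀ c₁) →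
    ∀ L : ℝ, 0 < L → ∃ ν₁ : ℝ, 0 < ν₁ ∧ ∀ ν : ℝ, 0 < ν → ν ≤ ν₁ → ∀ c : ℝ,
      TwoUnstableDirections ν L c (fun _ y => burgersLayerProfile 1 ν 1 y) (fun _ _ => 0) := by
  sorry

/-- **LM — every PARALLEL relative equilibrium of the `L`-cell is doubly unstable for `ν ≤ ν₁(L)`** (proved from the
registered stubs LM1 + LM2: a parallel relative equilibrium IS the Burgers layer, which LM2 makes doubly unstable).
[folklore] -/
theorem laminarModes_of
    (h1 : ∀ (ν L c : ℝ) (ue ve pe : ℝ → ℝ → ℝ), 0 < ν → 0 < L →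
      IsRelEquilibrium ν L c ue ve pe → (∀ x x' y : ℝ, ue x y = ue x' y) →
        ∀ x y : ℝ, ue x y = burgersLayerProfile 1 ν 1 y ∧ ve x y = 0)
    (h2 : (∃ α₁ h₀ c₁ : ℝ, 0 < α₁ ∧ 0 < h₀ ∧ 0 < c₁ ∧ BurgersLayerKHLongWave α₁ h₀ c₁) →
      ∀ L : ℝ, 0 < L → ∃ ν₁ : ℝ, 0 < ν₁ ∧ ∀ ν : ℝ, 0 < ν → ν ≤ ν₁ → ∀ c : ℝ,
        TwoUnstableDirections ν L c (fun _ y => burgersLayerProfile 1 ν 1 y) (fun _ _ => 0)) :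
    (∃ α₁ h₀ c₁ : ℝ, 0 < α₁ ∧ 0 < h₀ ∧ 0 < c₁ ∧ BurgersLayerKHLongWave α₁ h₀ c₁) →
    ∀ L : ℝ, 0 < L → ∃ ν₁ : ℝ, 0 < ν₁ ∧ ∀ ν : ℝ, 0 < ν → ν ≤ ν₁ →
      ∀ (c : ℝ) (ue ve pe : ℝ → ℝ → ℝ), IsRelEquilibrium ν L c ue ve pe →
        (∀ x x' y : ℝ, ue x y = ue x' y) → TwoUnstableDirections ν L c ue ve := by
  intro hLW L hL
  obtain ⟨ν₁, hν₁, h⟩ := h2 hLW L hL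
  refine ⟨ν₁, hν₁, fun ν hν hνle c ue ve pe he hpar => ?_⟩
  have hprof := h1 ν L c ue ve pe hν hL he hpar
  have hue : ue = fun _ y => burgersLayerProfile 1 ν 1 y := funext fun x => funext fun y => (hprof x y).1
  have hve : ve = fun _ _ => (0 : ℝ) := funext fun x => funext fun y => (hprof x y).2
  rw [hue, hve]
  exact h ν hν hνle c

/-- **Stub NP — THE INDEX GAP FOR NON-PARALLEL RELATIVE EQUILIBRIA (HARDEST static stub; conjectural).** There is a universal
`c₀ > 0` such that for every period `L` some `ν₂(L) > 0` makes every NON-parallel relative equilibrium of the `L`-cell at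
`ν ≤ ν₂` with exponential shear tails and SMALL dissipation `D(e) < c₀·min(L,1)` doubly unstable. Heuristic census of the zoo
(Disproof §3, card §Mechanism): small dissipation forces the pinned circulation `−L` per period to be SPREAD — by Cauchy–Schwarz
`D ≥ L/(8πN)` for `N` concentrated cores of any signs (`row_dissipation_per_area`), so `D < c₀ min(L,1)` with `c₀ < 1/16π` means
`N ≥ 3` cores (pairing modes `m = 1, …, N−1`, all unstable under the strain: `strainedRow_pairing_unstable`; real unstable
dimension `N − 1 ≥ 2`) or sheet-like pieces (Kelvin–Helmholtz, many modes, LM/LW) — while the index-0 and index-1 states (one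
Burgers vortex per period, `D → L/8π`; the 2-row, `D → L/16π`) sit ABOVE the threshold: the dissipation spectrum of the
low-index equilibria is QUANTISED away from zero, uniformly in ν. `c₀` is existential (typing checklist (iv)); the full space is
used, not an `S`-symmetric class (triage r2-1/r2-2: `index_S(N-row) = ⌊(N−1)/2⌋` would break the gap). WHY IT MIGHT FAIL: an
exotic non-parallel tailed equilibrium with spread vorticity but real unstable dimension ≤ 1 — e.g. a small-amplitude mixed
state bifurcating from `U_B^ν` at a near-neutral high harmonic whose inherited subharmonic (pairing) instabilities are
unexpectedly stabilised by the strain, or a travelling (`c ≠ 0`) unequal-core row; no classification of the steady states of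
the strained layer exists (Kerr 2024 §3, Gallay–Maekawa λ < 1 only). SIZE: XL / open (spectral theory of every low-dissipation
equilibrium); its first rungs (N-rows of near-Burgers cores for `ν ≤ ν₂`, weakly modulated layers) are theorem-sized. [folklore] -/
theorem stub_indexGapNonparallel : ∃ c₀ : ℝ, 0 < c₀ ∧ ∀ L : ℝ, 0 < L → ∃ ν₂ : ℝ, 0 < ν₂ ∧
    ∀ ν : ℝ, 0 < ν → ν ≤ ν₂ → ∀ (c : ℝ) (ue ve pe : ℝ → ℝ → ℝ), IsRelEquilibrium ν L c ue ve pe →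
      (∃ C k : ℝ, 0 < k ∧ SliceTails C k ue ve) → (∃ x x' y : ℝ, ue x y ≠ ue x' y) →
        layerDissipation ν L ue ve < ENNReal.ofReal (c₀ * min L 1) →
          TwoUnstableDirections ν L c ue ve := by
  sorry

/-- **Stub G — CONVERGENCE TO A RELATIVE EQUILIBRIUM AT FIXED ν (the line's one dynamical bet; conjectural).** For every
`ν > 0`, `L > 0`, admissible θ and every member of the class from `U_B^ν + θ` with locally finite dissipation and exponential
shear tails on every `[a,b] ⊂ (0,∞)`: the solution converges MODULO `x`-TRANSLATION, uniformly in `C¹`, to ONE tailed relative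
equilibrium `e = (c, ue, ve, pe)` of the cell, and its dissipation converges to `D(e)` in `[0,∞]`. No rate, no uniformity in
ν — this is a fixed-ν qualitative statement (compact absorbing set from the fixed-ν a-priori chain landed for the sum-rule line,
`stub_vorticityUniformBounds` p120637; gradient-like structure / Łojasiewicz–Simon convergence near the normally hyperbolic
translation orbit, Hale–Raugel 1992, Brunovský–Poláčik; the dissipation converges because `∇u(t) → ∇ue` uniformly with uniform
exponential tails). WHY IT MIGHT FAIL: the stretched layer at fixed small ν need not be gradient-like — a time-periodic or
quasi-periodic terminal regime (Hopf bifurcation off a vortex-row branch, leap-frogging cores), or an ω-limit CONTINUUM of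
non-translate equilibria (convergence to a single one then needs analyticity/Łojasiewicz); either kills G as typed (a reshape
to "ω-limit set ⊂ relative equilibria ∪ …" would then be needed, and NP/A would have to be re-cut for invariant sets).
SIZE: XL / open. [folklore] -/
theorem stub_convergenceToEquilibrium : ∀ (ν L : ℝ), 0 < ν → 0 < L → ∀ (θ₁ θ₂ : ℝ → ℝ → ℝ),
    IsAdmissible L θ₁ θ₂ → ∀ (u v p : ℝ → ℝ → ℝ → ℝ), InCruxClass ν L θ₁ θ₂ u v p →
      (∀ T : ℝ, 0 < T → ∫⁻ t in Ioc 0 T, layerDissipation ν L (u t) (v t) ≠ ∞) →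
      (∀ a b : ℝ, 0 < a → a < b → ExpTails (Icc a b) u v) →
        ∃ (c : ℝ) (ue ve pe : ℝ → ℝ → ℝ), IsRelEquilibrium ν L c ue ve pe ∧
          (∃ C k : ℝ, 0 < k ∧ SliceTails C k ue ve) ∧ ConvergesModTranslation u v ue ve ∧
          Tendsto (fun t => layerDissipation ν L (u t) (v t)) atTop (𝓝 (layerDissipation ν L ue ve)) := by
  sorry

/-- **Stub A — GENERIC AVOIDANCE OF DOUBLY-UNSTABLE EQUILIBRIA (one θ for all small ν).** For every period `L` there is ONE
admissible θ and `ν₃ > 0` such that for every `ν ≤ ν₃` no tailed finite-dissipation member of the class from `U_B^ν + θ`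
converges modulo translation to a relative equilibrium with two unstable directions. Mechanism: at fixed ν the semiflow on the
tailed finite-dissipation phase space is `C¹` and injective with injective linearisation (backward uniqueness), the
centre-stable set of the translation CIRCLE of a doubly-unstable relative equilibrium is a countable union of `C¹` submanifolds
of codimension ≥ 2 (Henry 1981 Ch. 6–7; Brunovský–Raugel 2003 Sard–Smale), the θ ↦ solution map restricted to a Banach space
of admissible θ (C², div-free, supported in `|y| ≤ R`, `L`-periodic) is transverse enough, so for each dyadic shell
`ν ∈ [2^{−j−1}ν₃, 2^{−j}ν₃]` the bad θ form a set of codimension ≥ 2 − 1 = 1 (one dimension lost to projecting out ν), meagre;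
a countable union of meagre sets is meagre (Baire), and any θ off it works for all `ν ≤ ν₃` at once. θ = 0 and every
`x`-independent θ are IN the bad set (they relaminarise, Disproof §2/§4, and `U_B^ν` is doubly unstable by LM) — consistent
with `∃θ` being load-bearing. Uniqueness in the TAILED finite-dissipation class (weak–strong) identifies "member" with "semiflow
orbit". WHY IT MIGHT FAIL: the transversality of θ ↦ u(t) onto a codimension-2 centre-stable set uniformly on a ν-shell is a
genuine Sard–Smale hypothesis (Fredholm unique continuation for the linearised stretched NS), unproved here; and if the set of
doubly-unstable relative equilibria is uncountable and non-smooth in ν the countable-union step breaks. SIZE: L–XL. [folklore] -/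
theorem stub_genericAvoidance : ∀ L : ℝ, 0 < L → ∃ θ₁ θ₂ : ℝ → ℝ → ℝ, IsAdmissible L θ₁ θ₂ ∧
    ∃ ν₃ : ℝ, 0 < ν₃ ∧ ∀ ν : ℝ, 0 < ν → ν ≤ ν₃ →
      ∀ (u v p : ℝ → ℝ → ℝ → ℝ), InCruxClass ν L θ₁ θ₂ u v p →
        (∀ T : ℝ, 0 < T → ∫⁻ t in Ioc 0 T, layerDissipation ν L (u t) (v t) ≠ ∞) →
        (∀ a b : ℝ, 0 < a → a < b → ExpTails (Icc a b) u v) →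
        ∀ (c : ℝ) (ue ve pe : ℝ → ℝ → ℝ), IsRelEquilibrium ν L c ue ve pe →
          ConvergesModTranslation u v ue ve → ¬ TwoUnstableDirections ν L c ue ve := by
  sorry

/-! ## §3 The composition (sorry-free): H, LW, LM, NP, G, A ⇒ the crux BY NAME -/

/-- **Conditional composition (sorry-free; registered sub-goal; its seven hypotheses are the seven registered stubs
H, LW, LM1, LM2, NP, G, A verbatim).** `c := c₀` (NP); given `L`: `ν₀ := min ν₁ (min ν₂ ν₃)` (LM = LM1 + LM2 via
`laminarModes_of`, NP, A) and θ from A; given `ν ≤ ν₀` and a member: if some `∫⁻₀^{T₀} D = ⊤` the means are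
eventually `⊤`; otherwise H gives tails, G a limiting tailed relative equilibrium `e` with `D(t) → D(e)`, A says `e` is not
doubly unstable, so `e` is not parallel (LM) and then NP's contrapositive gives `D(e) ≥ c₀ min(L,1)`; the terminal-value
transfer concludes. [folklore] -/
theorem StrainedLayerLaw_of_indexGapStubs
    (hH : ∀ (ν L : ℝ), 0 < ν → 0 < L → ∀ (θ₁ θ₂ : ℝ → ℝ → ℝ), IsAdmissible L θ₁ θ₂ →
      ∀ (u v p : ℝ → ℝ → ℝ → ℝ), InCruxClass ν L θ₁ θ₂ u v p →
        (∀ T : ℝ, 0 < T → ∫⁻ t in Ioc 0 T, layerDissipation ν L (u t) (v t) ≠ ∞) →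
          ∀ a b : ℝ, 0 < a → a < b → ExpTails (Icc a b) u v)
    (hLW : ∃ α₁ h₀ c₁ : ℝ, 0 < α₁ ∧ 0 < h₀ ∧ 0 < c₁ ∧ BurgersLayerKHLongWave α₁ h₀ c₁)
    (hLM1 : ∀ (ν L c : ℝ) (ue ve pe : ℝ → ℝ → ℝ), 0 < ν → 0 < L →
      IsRelEquilibrium ν L c ue ve pe → (∀ x x' y : ℝ, ue x y = ue x' y) →
        ∀ x y : ℝ, ue x y = burgersLayerProfile 1 ν 1 y ∧ ve x y = 0)
    (hLM2 : (∃ α₁ h₀ c₁ : ℝ, 0 < α₁ ∧ 0 < h₀ ∧ 0 < c₁ ∧ BurgersLayerKHLongWave α₁ h₀ c₁) →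
      ∀ L : ℝ, 0 < L → ∃ ν₁ : ℝ, 0 < ν₁ ∧ ∀ ν : ℝ, 0 < ν → ν ≤ ν₁ → ∀ c : ℝ,
        TwoUnstableDirections ν L c (fun _ y => burgersLayerProfile 1 ν 1 y) (fun _ _ => 0))
    (hNP : ∃ c₀ : ℝ, 0 < c₀ ∧ ∀ L : ℝ, 0 < L → ∃ ν₂ : ℝ, 0 < ν₂ ∧
      ∀ ν : ℝ, 0 < ν → ν ≤ ν₂ → ∀ (c : ℝ) (ue ve pe : ℝ → ℝ → ℝ), IsRelEquilibrium ν L c ue ve pe →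
        (∃ C k : ℝ, 0 < k ∧ SliceTails C k ue ve) → (∃ x x' y : ℝ, ue x y ≠ ue x' y) →
          layerDissipation ν L ue ve < ENNReal.ofReal (c₀ * min L 1) →
            TwoUnstableDirections ν L c ue ve)
    (hG : ∀ (ν L : ℝ), 0 < ν → 0 < L → ∀ (θ₁ θ₂ : ℝ → ℝ → ℝ),
      IsAdmissible L θ₁ θ₂ → ∀ (u v p : ℝ → ℝ → ℝ → ℝ), InCruxClass ν L θ₁ θ₂ u v p →
        (∀ T : ℝ, 0 < T → ∫⁻ t in Ioc 0 T, layerDissipation ν L (u t) (v t) ≠ ∞) →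
        (∀ a b : ℝ, 0 < a → a < b → ExpTails (Icc a b) u v) →
          ∃ (c : ℝ) (ue ve pe : ℝ → ℝ → ℝ), IsRelEquilibrium ν L c ue ve pe ∧
            (∃ C k : ℝ, 0 < k ∧ SliceTails C k ue ve) ∧ ConvergesModTranslation u v ue ve ∧
            Tendsto (fun t => layerDissipation ν L (u t) (v t)) atTop (𝓝 (layerDissipation ν L ue ve)))
    (hA : ∀ L : ℝ, 0 < L → ∃ θ₁ θ₂ : ℝ → ℝ → ℝ, IsAdmissible L θ₁ θ₂ ∧
      ∃ ν₃ : ℝ, 0 < ν₃ ∧ ∀ ν : ℝ, 0 < ν → ν ≤ ν₃ →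
        ∀ (u v p : ℝ → ℝ → ℝ → ℝ), InCruxClass ν L θ₁ θ₂ u v p →
          (∀ T : ℝ, 0 < T → ∫⁻ t in Ioc 0 T, layerDissipation ν L (u t) (v t) ≠ ∞) →
          (∀ a b : ℝ, 0 < a → a < b → ExpTails (Icc a b) u v) →
          ∀ (c : ℝ) (ue ve pe : ℝ → ℝ → ℝ), IsRelEquilibrium ν L c ue ve pe →
            ConvergesModTranslation u v ue ve → ¬ TwoUnstableDirections ν L c ue ve) :
    StrainedLayerLaw := by
  obtain ⟨c₀, hc₀, hNP⟩ := hNP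
  refine ⟨c₀, hc₀, ?_⟩
  intro L hL
  obtain ⟨ν₁, hν₁, hLM⟩ := laminarModes_of hLM1 hLM2 hLW L hL
  obtain ⟨ν₂, hν₂, hNP⟩ := hNP L hL
  obtain ⟨θ₁, θ₂, hθ, ν₃, hν₃, hA⟩ := hA L hL
  refine ⟨min ν₁ (min ν₂ ν₃), lt_min hν₁ (lt_min hν₂ hν₃), θ₁, θ₂, hθ.1, hθ.2.1, hθ.2.2.1, hθ.2.2.2.1,
    hθ.2.2.2.2, ?_⟩
  intro ν hν hνle u v p
  show InCruxClass ν L θ₁ θ₂ u v p → ENNReal.ofReal (c₀ * min L 1) ≤ meanLayerDissipation ν L u v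
  intro hcl
  have hν₁' : ν ≤ ν₁ := hνle.trans (min_le_left _ _)
  have hν₂' : ν ≤ ν₂ := hνle.trans ((min_le_right _ _).trans (min_le_left _ _))
  have hν₃' : ν ≤ ν₃ := hνle.trans ((min_le_right _ _).trans (min_le_right _ _))
  rw [meanLayerDissipation_def]
  by_cases hfin : ∀ T : ℝ, 0 < T → ∫⁻ t in Ioc 0 T, layerDissipation ν L (u t) (v t) ≠ ∞
  swap
  · rw [liminf_cesaro_eq_top_of_not_locFinite hfin]
    exact le_top
  have htails : ∀ a b : ℝ, 0 < a → a < b → ExpTails (Icc a b) u v := hH ν L hν hL θ₁ θ₂ hθ u v p hcl hfin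
  obtain ⟨c, ue, ve, pe, he, hte, hconv, hD⟩ := hG ν L hν hL θ₁ θ₂ hθ u v p hcl hfin htails
  have hnot : ¬ TwoUnstableDirections ν L c ue ve := hA ν hν hν₃' u v p hcl hfin htails c ue ve pe he hconv
  have hfloor : ENNReal.ofReal (c₀ * min L 1) ≤ layerDissipation ν L ue ve := by
    by_cases hpar : ∀ x x' y : ℝ, ue x y = ue x' y
    · exact absurd (hLM ν hν hν₁' c ue ve pe he hpar) hnot
    · push Not at hpar
      obtain ⟨x, x', y, hne⟩ := hpar
      exact not_lt.1 fun hlt => hnot (hNP ν hν hν₂' c ue ve pe he hte ⟨x, x', y, hne⟩ hlt)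
  exact le_liminf_cesaro_of_tendsto hD hfloor

/-- **Composition.** The seven registered stubs (H, LW, LM1, LM2, NP, G, A), fed to the sorry-free conditional
composition, prove the crux BY NAME. [folklore] -/
theorem StrainedLayerLaw_of : StrainedLayerLaw :=
  StrainedLayerLaw_of_indexGapStubs stub_bareClassTails stub_longWaveKH stub_laminarProfile stub_laminarUnstable
    stub_indexGapNonparallel stub_convergenceToEquilibrium stub_genericAvoidance

end Summit.AnomalousDissipation.AnomalousDissipation.Cruxes.StrainedLayerLaw.IndexGapQuantisedDissipation

end
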